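import Summits.HubbardSuperconductivity.HubbardSuperconductivity.Theses.PlaquetteBoson
import Summits.HubbardSuperconductivity.HubbardSuperconductivity.Theses.AnisotropyChord
import Summits.HubbardSuperconductivity.HubbardSuperconductivity.Theses.PolyaSchurPairBoson
import HarnessLib

/-!
# Crux `PbAnchorOrder` (stmt-HubbardSuperconductivity-0905, route `PlaquetteBoson` rank 3) — ALTERNATIVE LINE
`Lines/half_filled_bridge.lean` (crux-strategist `planner-cstrat-stmt-HubbardSuperconductivity-0905-s2-0`, 2026-08-17;
companion card `Lines/half-filled-bridge.md`, census `STRATEGY-CENSUS.md` §Decomposition D3, glue file `SplitGlue.lean`).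

THE LINE = the canonical decomposition of the anchor into the two EXISTING items it literally consists of:

* `stub_halfFilledXYOrder` — VERBATIM the signature of this route's crux `PbHalfFilledXYOrder`
  (stmt-HubbardSuperconductivity-0906; shared as the support `HalfFilledOrder` of routes AnisotropyChord / LevyLogBootstrap):
  half-filled easy-plane XY order of the `S = ½` ferro-XY/AF-Ising torus gas on the whole interval `Δ ∈ (−1, 0]`
  (needed at the plaquette lock-in `Δ_eff(U) ≈ −0.99`; engines filed: LP/SDP bootstrap of this route, Pólya–Schur Theorem S of
  PolyaSchurPairBoson, the anisotropy chord of AnisotropyChord).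
* `stub_dressHalfFilled` — VERBATIM the signature of `AnisotropyChord.DressHalfFilled` (stmt-HubbardSuperconductivity-8148, shared with
  LevyLogBootstrap), which is BY `Iff.rfl` the implication `PbHalfFilledXYOrder → PbAnchorOrder` (`dressHalfFilled_iff` below): the
  dressing at the WITNESS DOPING `δ = ¼` = boson half filling = the reflection-positive `S^z_tot = 0` sector of the reference gas
  (certified plaquette window + Schrieffer–Wolff dictionary + gapless-order dressing; its own skeleton and three round-1 crux ideas live
  under `Cruxes/DressHalfFilled/`).

COMPOSITION `PbAnchorOrder_of : Sig.stub_halfFilledXYOrder → Sig.stub_dressHalfFilled → PbAnchorOrder` = modus ponens (proved);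
`PbAnchorOrder_proof` is the A12 form.  Why this cut and not `birth`: the item is existential in `δ`, and at `δ = ¼` (i) no monotone
depletion (stmt-0904) and no any-filling condensate (stmt-10288) is consumed, (ii) the reference XXZ gas is reflection positive — the
structure every filed dressing idea (feshbach-pair-vacuum, rp-point-taylor-transfer, smeared-kls-variational on stmt-8148) uses — and
(iii) both stubs ARE staffed items, so a lead of THIS crux should not re-cut their content a third time (birth's `stub_plaquetteWindow`
= 8148/10291's window stub; birth's `stub_dressing` = 10291's dressing at a worse filling).

NOT skeleton-registered by the strategist (a `skeleton check` replaces the item's single live skeleton pointer = `Lines/birth.lean`);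
a lead who picks this line registers it.  Farm `lean check`: rc 0, sorries = the two stubs only.

DISPROOF USED: none exists for this crux (`ledger crux ls`: no `Disproof.lean`, no `Negative/`).  Negatives index read (2 entries):
`KlsOrderOpenness` (DM helix) concerns the dressing's future stability statement (pinned wave vector: the Schrieffer–Wolff remainder is
real and site-inversion even) — recorded on 8148's ideas; `BreathingSelfDual` (`L = 2` artefact) — everything here is eventual in `L ∈ 4ℕ`.
Sources: Yao–Tsai–Kivelson 2007 [YaoTsaiKivelson2007]; Kennedy–Lieb–Shastry 1988 [KLS1988PRL]; Kubo–Kishi 1988 [KuboKishi1988].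
-/

noncomputable section

set_option linter.dupNamespace false

namespace Summit.HubbardSuperconductivity.HubbardSuperconductivity.Cruxes.PbAnchorOrder.HalfFilledBridge

open scoped BigOperators Matrix ComplexOrder ComplexConjugate
open Summit.HubbardSuperconductivity.HubbardSuperconductivity.Theses
open Summit.HubbardSuperconductivity.HubbardSuperconductivity.Theses.PlaquetteBoson (PbAnchorOrder PbHalfFilledXYOrder)

/-! ### Stub signatures (verbatim item signatures) -/

/-- STUB 1 signature = stmt-HubbardSuperconductivity-0906 `PlaquetteBoson.PbHalfFilledXYOrder`, verbatim. -/
def Sig.stub_halfFilledXYOrder : Prop :=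
  ∀ Δ ∈ Set.Ioc (-1:ℝ) 0, ∃ c : ℝ, 0 < c ∧ ∃ M₀ : ℕ, ∀ (M : ℕ) [NeZero M], Even M → M₀ ≤ M → ∀ (ψ : Literature.MathematicalPhysics.QuantumLattice.TensorIndex (Literature.Probability.LatticeModels.TorusSite 2 M) 2 → ℂ), ψ ∈ Literature.MathematicalPhysics.QuantumLattice.spinZSector (Λ := Literature.Probability.LatticeModels.TorusSite 2 M) 1 0 → star ψ ⬝ᵥ ψ = 1 → Matrix.mulVec (Literature.MathematicalPhysics.QuantumLattice.xxzHamiltonian 1 (Literature.Probability.LatticeModels.torusGraph 2 M) (-1) Δ) ψ = ((Literature.MathematicalPhysics.QuantumLattice.lowestEnergyInSector 1 (Literature.MathematicalPhysics.QuantumLattice.xxzHamiltonian 1 (Literature.Probability.LatticeModels.torusGraph 2 M) (-1) Δ) 0 : ℝ) : ℂ) • ψ → c * (M : ℝ) ^ 4 ≤ (star ψ ⬝ᵥ Matrix.mulVec ((∑ x : Literature.Probability.LatticeModels.TorusSite 2 M, Literature.MathematicalPhysics.QuantumLattice.onSite x (Literature.MathematicalPhysics.QuantumLattice.spinRaise 1))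 * (∑ y : Literature.Probability.LatticeModels.TorusSite 2 M, Literature.MathematicalPhysics.QuantumLattice.onSite y (Literature.MathematicalPhysics.QuantumLattice.spinLower 1))) ψ).re

/-- STUB 2 signature = stmt-HubbardSuperconductivity-8148 `AnisotropyChord.DressHalfFilled`, verbatim. -/
def Sig.stub_dressHalfFilled : Prop :=
  (∀ Δ ∈ Set.Ioc (-1:ℝ) 0, ∃ c : ℝ, 0 < c ∧ ∃ M₀ : ℕ, ∀ (M : ℕ) [NeZero M], Even M → M₀ ≤ M → ∀ (ψ : Literature.MathematicalPhysics.QuantumLattice.TensorIndex (Literature.Probability.LatticeModels.TorusSite 2 M) 2 → ℂ), ψ ∈ Literature.MathematicalPhysics.QuantumLattice.spinZSector (Λ := Literature.Probability.LatticeModels.TorusSite 2 M) 1 0 → star ψ ⬝ᵥ ψ = 1 → Matrix.mulVec (Literature.MathematicalPhysics.QuantumLattice.xxzHamiltonian 1 (Literature.Probability.LatticeModels.torusGraph 2 M) (-1) Δ) ψ = ((Literature.MathematicalPhysics.QuantumLattice.lowestEnergyInSector 1 (Literature.MathematicalPhysics.QuantumLattice.xxzHamiltonian 1 (Literature.Probability.LatticeModels.torusGraph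 2 M) (-1) Δ) 0 : ℝ) : ℂ) • ψ → c * (M : ℝ) ^ 4 ≤ (star ψ ⬝ᵥ Matrix.mulVec ((∑ x : Literature.Probability.LatticeModels.TorusSite 2 M, Literature.MathematicalPhysics.QuantumLattice.onSite x (Literature.MathematicalPhysics.QuantumLattice.spinRaise 1)) * (∑ y : Literature.Probability.LatticeModels.TorusSite 2 M, Literature.MathematicalPhysics.QuantumLattice.onSite y (Literature.MathematicalPhysics.QuantumLattice.spinLower 1))) ψ).re) → (∃ U : ℝ, 0 < U ∧ ∃ δ ∈ Set.Ioo (0:ℝ) (1/2), ∃ t₀ : ℝ, 0 < t₀ ∧ ∀ t' ∈ Set.Ioo (0:ℝ) t₀, ∃ c : ℝ, 0 < c ∧ ∃ L₀ : ℕ, ∀ (L : ℕ) [NeZero L], L₀ ≤ L → 4 ∣ L → ∀ (N : ℕ) (ψ : Literature.MathematicalPhysics.QuantumLattice.Fock (Literature.MathematicalPhysics.QuantumLattice.Orb (Literature.MathematicalPhysics.QuantumLattice.FermionTorus 2 L))), N = 2 * ⌊(1 - δ) * (L : ℝ) ^ 2 / 2⌋₊ → star ψ ⬝ᵥ ψ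 = 1 → Literature.MathematicalPhysics.QuantumLattice.IsGroundStateInSector (Literature.MathematicalPhysics.QuantumLattice.hamiltonian ((Literature.MathematicalPhysics.QuantumLattice.fermionTorusGraph 2 L) \ SimpleGraph.comap (fun x : Literature.MathematicalPhysics.QuantumLattice.FermionTorus 2 L => fun i : Fin 2 => ((ofLex x) i : ℕ) / 2) ⊤) 1 U + Literature.MathematicalPhysics.QuantumLattice.hamiltonian ((Literature.MathematicalPhysics.QuantumLattice.fermionTorusGraph 2 L) ⊓ SimpleGraph.comap (fun x : Literature.MathematicalPhysics.QuantumLattice.FermionTorus 2 L => fun i : Fin 2 => ((ofLex x) i : ℕ) / 2) ⊤) t' 0) N 0 ψ → c * (L : ℝ) ^ 4 ≤ (Literature.MathematicalPhysics.QuantumLattice.expect ((Literature.MathematicalPhysics.QuantumLattice.pairField Literature.MathematicalPhysics.QuantumLattice.dWaveFormFactor L)ᴴ * Literature.MathematicalPhysics.QuantumLattice.pairField Literature.MathematicalPhysics.QuantumLattice.dWaveFormFactor L) ψ).re)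

/-- Stub 1 IS the route item `PbHalfFilledXYOrder` (syntactic identity). [bookkeeping] -/
theorem sig_halfFilledXYOrder_iff : Sig.stub_halfFilledXYOrder ↔ PbHalfFilledXYOrder := Iff.rfl

/-- Stub 2 IS the shared item `AnisotropyChord.DressHalfFilled` (syntactic identity). [bookkeeping] -/
theorem sig_dressHalfFilled_iff : Sig.stub_dressHalfFilled ↔ AnisotropyChord.DressHalfFilled := Iff.rfl

/-- `AnisotropyChord.DressHalfFilled` is literally `PbHalfFilledXYOrder → PbAnchorOrder`. [bookkeeping] -/
theorem dressHalfFilled_iff : AnisotropyChord.DressHalfFilled ↔ (PbHalfFilledXYOrder → PbAnchorOrder) := Iff.rfl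

/-! ### Registered-shape stubs (sorries live ONLY here) -/

/-- **STUB 1 `stub_halfFilledXYOrder`** = item stmt-0906 (half-filled XY order of the `S = ½` XXZ torus on `(−1,0]`; known for
`|Δ| ≲ 0.2` by RP + KLS, tree `kennedy_lieb_shastry_xy_ground_holds` at `Δ = 0`; open near `−1`). -/
theorem stub_halfFilledXYOrder :
    ∀ Δ ∈ Set.Ioc (-1:ℝ) 0, ∃ c : ℝ, 0 < c ∧ ∃ M₀ : ℕ, ∀ (M : ℕ) [NeZero M], Even M → M₀ ≤ M → ∀ (ψ : Literature.MathematicalPhysics.QuantumLattice.TensorIndex (Literature.Probability.LatticeModels.TorusSite 2 M) 2 → ℂ), ψ ∈ Literature.MathematicalPhysics.QuantumLattice.spinZSector (Λ := Literature.Probability.LatticeModels.TorusSite 2 M) 1 0 → star ψ ⬝ᵥ ψ = 1 → Matrix.mulVec (Literature.MathematicalPhysics.QuantumLattice.xxzHamiltonian 1 (Literature.Probability.LatticeModels.torusGraph 2 M) (-1) Δ) ψ = ((Literature.MathematicalPhysics.QuantumLattice.lowestEnergyInSector 1 (Literature.MathematicalPhysics.QuantumLattice.xxzHamiltonian 1 (Literature.Probability.LatticeModels.torusGraph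 2 M) (-1) Δ) 0 : ℝ) : ℂ) • ψ → c * (M : ℝ) ^ 4 ≤ (star ψ ⬝ᵥ Matrix.mulVec ((∑ x : Literature.Probability.LatticeModels.TorusSite 2 M, Literature.MathematicalPhysics.QuantumLattice.onSite x (Literature.MathematicalPhysics.QuantumLattice.spinRaise 1)) * (∑ y : Literature.Probability.LatticeModels.TorusSite 2 M, Literature.MathematicalPhysics.QuantumLattice.onSite y (Literature.MathematicalPhysics.QuantumLattice.spinLower 1))) ψ).re := by
  sorry

/-- **STUB 2 `stub_dressHalfFilled`** = item stmt-8148 (the half-filled dressing: 0906 ⇒ the anchor body at `δ = ¼`; hardest stub). -/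
theorem stub_dressHalfFilled :
    (∀ Δ ∈ Set.Ioc (-1:ℝ) 0, ∃ c : ℝ, 0 < c ∧ ∃ M₀ : ℕ, ∀ (M : ℕ) [NeZero M], Even M → M₀ ≤ M → ∀ (ψ : Literature.MathematicalPhysics.QuantumLattice.TensorIndex (Literature.Probability.LatticeModels.TorusSite 2 M) 2 → ℂ), ψ ∈ Literature.MathematicalPhysics.QuantumLattice.spinZSector (Λ := Literature.Probability.LatticeModels.TorusSite 2 M) 1 0 → star ψ ⬝ᵥ ψ = 1 → Matrix.mulVec (Literature.MathematicalPhysics.QuantumLattice.xxzHamiltonian 1 (Literature.Probability.LatticeModels.torusGraph 2 M) (-1) Δ) ψ = ((Literature.MathematicalPhysics.QuantumLattice.lowestEnergyInSector 1 (Literature.MathematicalPhysics.QuantumLattice.xxzHamiltonian 1 (Literature.Probability.LatticeModels.torusGraph 2 M) (-1) Δ) 0 : ℝ) : ℂ) • ψ → c * (M : ℝ) ^ 4 ≤ (star ψ ⬝ᵥ Matrix.mulVec ((∑ x : Literature.Probability.LatticeModels.TorusSite 2 M, Literature.MathematicalPhysics.QuantumLattice.onSite x (Literature.MathematicalPhysics.QuantumLattice.spinRaise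 1)) * (∑ y : Literature.Probability.LatticeModels.TorusSite 2 M, Literature.MathematicalPhysics.QuantumLattice.onSite y (Literature.MathematicalPhysics.QuantumLattice.spinLower 1))) ψ).re) → (∃ U : ℝ, 0 < U ∧ ∃ δ ∈ Set.Ioo (0:ℝ) (1/2), ∃ t₀ : ℝ, 0 < t₀ ∧ ∀ t' ∈ Set.Ioo (0:ℝ) t₀, ∃ c : ℝ, 0 < c ∧ ∃ L₀ : ℕ, ∀ (L : ℕ) [NeZero L], L₀ ≤ L → 4 ∣ L → ∀ (N : ℕ) (ψ : Literature.MathematicalPhysics.QuantumLattice.Fock (Literature.MathematicalPhysics.QuantumLattice.Orb (Literature.MathematicalPhysics.QuantumLattice.FermionTorus 2 L))), N = 2 * ⌊(1 - δ) * (L : ℝ) ^ 2 / 2⌋₊ → star ψ ⬝ᵥ ψ = 1 → Literature.MathematicalPhysics.QuantumLattice.IsGroundStateInSector (Literature.MathematicalPhysics.QuantumLattice.hamiltonian ((Literature.MathematicalPhysics.QuantumLattice.fermionTorusGraph 2 L) \ SimpleGraph.comap (fun x : Literature.MathematicalPhysics.QuantumLattice.FermionTorus 2 L => fun i : Fin 2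 => ((ofLex x) i : ℕ) / 2) ⊤) 1 U + Literature.MathematicalPhysics.QuantumLattice.hamiltonian ((Literature.MathematicalPhysics.QuantumLattice.fermionTorusGraph 2 L) ⊓ SimpleGraph.comap (fun x : Literature.MathematicalPhysics.QuantumLattice.FermionTorus 2 L => fun i : Fin 2 => ((ofLex x) i : ℕ) / 2) ⊤) t' 0) N 0 ψ → c * (L : ℝ) ^ 4 ≤ (Literature.MathematicalPhysics.QuantumLattice.expect ((Literature.MathematicalPhysics.QuantumLattice.pairField Literature.MathematicalPhysics.QuantumLattice.dWaveFormFactor L)ᴴ * Literature.MathematicalPhysics.QuantumLattice.pairField Literature.MathematicalPhysics.QuantumLattice.dWaveFormFactor L) ψ).re) := by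
  sorry

/-! ### Composition -/

/-- **The line closes the crux BY NAME modulo the two stubs**: modus ponens. -/
theorem PbAnchorOrder_of : Sig.stub_halfFilledXYOrder → Sig.stub_dressHalfFilled → PbAnchorOrder :=
  fun hHF hD => dressHalfFilled_iff.mp (sig_dressHalfFilled_iff.mp hD) (sig_halfFilledXYOrder_iff.mp hHF)

/-- A12 form: the crux by name from the two stubs (depends on `sorryAx` only through them). -/
theorem PbAnchorOrder_proof : PbAnchorOrder :=
  PbAnchorOrder_of stub_halfFilledXYOrder stub_dressHalfFilled

end Summit.HubbardSuperconductivity.HubbardSuperconductivity.Cruxes.PbAnchorOrder.HalfFilledBridge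

end
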